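import Summits.CriticalPhenomena.PercolationContinuityZ3.Theorems.PercNearOneGluingAdditiveGluingThreePointTransfer
import Literature.Probability.Percolation.KozmaNitzanPreFKG
import HarnessLib

/-!
# Crux `PercNearOneGluing.AdditiveGluing` (stmt-CriticalPhenomena-4576): the killed exchange step (EXK)

Support lemma (`--supports stmt-CriticalPhenomena-4576`, helper) for the kernel `stub_k0CovTransferQ_c9`
of line `tieline`.  Notation: weighted graph on `Fin n`, `μ = prodBernoulli w`, relays `u, v`,
observer `o`, spectator `c`; `D = {u ↮ v}`, `D' = D ∩ {v ↮ c}`, `T3 = D ∩ {c ↮ u} ∩ {c ↮ v}`,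
`L = C_v`, `M = C_c`, `U` an event increasing in `L`.

The relay-free covariance transfer (CT₀, `clusterCovTransfer`) is proved by Harris for
`(U, {v↮o} ∩ {o↮c})` plus the BHK exchange `μ(D'∩{o↔c})·μ(D'∩U) ≥ μ(D')·μ(D'∩U∩{o↔c})`.  Under the
killing by the ghost `u` (the setting of the kernel's L-face master inequality (SD)) the exchange step
acquires guards, and the correct killed form — the one that stays true, 0 violations in 588 exact
instances over all up-sets (memo `EXCHCERT-g5.md` §8) — is

`μ(T3 ∩ {o↔c}) · [μ(D∩U) μ(D') − μ(D'∩U) μ(D)] ≤ μ(T3) · [μ(D∩U) μ(D'∩{o↔c}) − μ(D'∩U∩{o↔c}) μ(D)]`,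

i.e. `t_S·|Cov_ν(U, E)| ≥ e_S·|Cov_ν(U, {c∉L})|` for the killed law `ν = μ(· | D)` of `L`,
`E = {c ∉ L} ∩ {o ∈ M}`.  Proof: (a) `μ(D∩U)/μ(D) ≥ μ(D'∩U)/μ(D')` (BHK Thm. 1.3, increasing × avoidance);
(b) under `{v ↮ {u,c}}` the events `{c ↮ u}` (type +) and `{c ↔ o}` (type −), and `U` (type +) and
`{c ↔ o}`, are negatively correlated (BHK Thm. 1.5 / 2.1 with the sets `{v}`, `{u,c}`,
`guardedTwoClusterExchange`); (c) bookkeeping.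
With (EXK), the kernel's (SD) is exactly `μ(T3)·Cov_ν(U, {v↮o}∩{o↮c}) ≤ slack(EXK)` (memo §8).

References: J. van den Berg, O. Häggström, J. Kahn, Random Struct. Alg. 29 (2006), Thm. 1.3 (p. 6),
Thm. 1.5 (p. 7), Thm. 2.1 (p. 9) [VandenbergHaggstromKahn2005].
-/

namespace Summit.CriticalPhenomena.PercolationContinuityZ3.Theorems

open MeasureTheory Set Literature.Probability.LatticeModels Literature.Probability.Percolation
open Literature.Probability.Percolation.KNPreFKG
open Summit.CriticalPhenomena.PercolationContinuityZ3.Cruxes.AdditiveGluing.TieLine.ThreePointTransfer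

namespace KilledExchange

variable {n : ℕ}

/-- An event increasing in `C_v` is the pull-back of an upper family of edge sets. [folklore] -/
theorem exists_upperFamily (v : Fin n) {U : Set (BondConfig (Fin n))}
    (hU : ∀ ⦃ω ω' : BondConfig (Fin n)⦄, openEdgeCluster ω v ⊆ openEdgeCluster ω' v → ω ∈ U → ω' ∈ U) :
    ∃ 𝒜 : Set (Set (Sym2 (Fin n))), IsUpperSet 𝒜 ∧ {ω : BondConfig (Fin n) | openEdgeCluster ω v ∈ 𝒜} = U := by
  refine ⟨{C | ∃ ω ∈ U, openEdgeCluster ω v ⊆ C}, ?_, ?_⟩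
  · intro C C' hCC' ⟨ω, hω, hC⟩
    exact ⟨ω, hω, hC.trans hCC'⟩
  · ext ω'
    simp only [mem_setOf_eq]
    exact ⟨fun ⟨ω, hω, hC⟩ => hU hC hω, fun h => ⟨ω', h, subset_refl _⟩⟩

/-- **(a) More avoidance lowers an increasing event** (BHK Thm. 1.3, increasing × decreasing):
`μ(D) · μ(D ∩ {v↮c} ∩ U) ≤ μ(D ∩ U) · μ(D ∩ {v↮c})`, `D = {u↮v}`.
[cite: VandenbergHaggstromKahn2005, Thm. 1.3 (p. 6, last sentence)] -/
theorem mono_avoid (w : Sym2 (Fin n) → unitInterval) (u v c : Fin n) (huv : u ≠ v)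
    {U : Set (BondConfig (Fin n))}
    (hU : ∀ ⦃ω ω' : BondConfig (Fin n)⦄, openEdgeCluster ω v ⊆ openEdgeCluster ω' v → ω ∈ U → ω' ∈ U) :
    (prodBernoulli w).real ((openConn u v)ᶜ : Set (BondConfig (Fin n))) *
        (prodBernoulli w).real ((openConn u v)ᶜ ∩ (openConn v c)ᶜ ∩ U) ≤
      (prodBernoulli w).real ((openConn u v)ᶜ ∩ U) *
        (prodBernoulli w).real ((openConn u v)ᶜ ∩ (openConn v c)ᶜ : Set (BondConfig (Fin n))) := by
  classical
  obtain ⟨𝒜, h𝒜, hAU⟩ := exists_upperFamily v hU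
  have hvu : v ∉ ({u} : Set (Fin n)) := fun h => huv (mem_singleton_iff.1 h).symm
  -- the (lower) family of edge sets avoiding `c`, read on `C_v`, is `{v ↮ c}` when `v ≠ c`
  have hlow : IsLowerSet {C : Set (Sym2 (Fin n)) | ∀ e ∈ C, c ∉ e} :=
    fun _ _ hDC hC e he hce => hC e (hDC he) hce
  have key := bhk_one_upper_lower w v ({u} : Set (Fin n)) hvu h𝒜 hlow
  have eD : {ω : BondConfig (Fin n) | ∀ x ∈ ({u} : Set (Fin n)), ¬ (openGraph ω).Reachable v x} =
      (openConn u v)ᶜ := by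
    ext ω
    simp only [mem_setOf_eq, mem_singleton_iff, forall_eq, mem_compl_iff, openConn_symm u v]
    rfl
  rw [eD, hAU] at key
  by_cases hvc : v = c
  · -- degenerate: `{v ↮ c} = ∅`
    subst hvc
    have h0 : ((openConn u v)ᶜ ∩ (openConn v v)ᶜ : Set (BondConfig (Fin n))) = ∅ := by
      ext ω
      simp only [mem_inter_iff, mem_compl_iff, mem_empty_iff_false, iff_false, not_and, not_not]
      intro _
      exact SimpleGraph.Reachable.refl _
    have h0' : ((openConn u v)ᶜ ∩ (openConn v v)ᶜ ∩ U : Set (BondConfig (Fin n))) = ∅ := by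
      rw [h0, empty_inter]
    rw [h0', h0, measureReal_empty, mul_zero, mul_zero]
  · have eC : {ω : BondConfig (Fin n) | openEdgeCluster ω v ∈ {C : Set (Sym2 (Fin n)) | ∀ e ∈ C, c ∉ e}} =
        (openConn v c)ᶜ := by
      ext ω
      simp only [mem_setOf_eq, mem_compl_iff]
      constructor
      · intro h hr
        rcases (reachable_iff_exists_mem_openEdgeCluster ω v c).1 hr with hcv | ⟨e, he, hce⟩
        · exact hvc hcv.symm
        · exact h e he hce
      · intro h e he hce
        exact h ((reachable_iff_exists_mem_openEdgeCluster ω v c).2 (Or.inr ⟨e, he, hce⟩))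
    rw [eC] at key
    -- key : μ(D) μ(D ∩ (U ∩ (vc)ᶜ)) ≤ μ(D ∩ U) μ(D ∩ (vc)ᶜ)
    have e1 : ((openConn u v)ᶜ ∩ (U ∩ (openConn v c)ᶜ) : Set (BondConfig (Fin n))) =
        (openConn u v)ᶜ ∩ (openConn v c)ᶜ ∩ U := by
      ext ω; simp only [mem_inter_iff]; tauto
    rw [e1] at key
    exact key

/-- The guard set `{v ↮ {u,c}}` as `D ∩ {v↮c}`. [folklore] -/
theorem sep_eq (u v c : Fin n) :
    {ω : BondConfig (Fin n) | ∀ s ∈ ({v} : Set (Fin n)), ∀ t ∈ ({u, c} : Set (Fin n)),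
        ¬ (openGraph ω).Reachable s t} = (openConn u v)ᶜ ∩ (openConn v c)ᶜ := by
  rw [sep_v_uc_eq, openConn_symm v u]

/-- **(b1) Exchange for `{c↮u}` vs `{c↔o}` under `{v ↮ {u,c}}`**:
`μ(D'∩{c↮u}∩{o↔c}) · μ(D') ≤ μ(D'∩{c↮u}) · μ(D'∩{o↔c})`, `D' = {u↮v} ∩ {v↮c}`.
[cite: VandenbergHaggstromKahn2005, Thm. 2.1 (p. 9) at q = 1] -/
theorem exch_guard (w : Sym2 (Fin n) → unitInterval) (o u v c : Fin n) :
    (prodBernoulli w).real ((openConn u v)ᶜ ∩ (openConn v c)ᶜ ∩ ((openConn c u)ᶜ ∩ openConn o c)) *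
        (prodBernoulli w).real ((openConn u v)ᶜ ∩ (openConn v c)ᶜ : Set (BondConfig (Fin n))) ≤
      (prodBernoulli w).real ((openConn u v)ᶜ ∩ (openConn v c)ᶜ ∩ (openConn c u)ᶜ) *
        (prodBernoulli w).real ((openConn u v)ᶜ ∩ (openConn v c)ᶜ ∩ openConn o c) := by
  have key := guardedTwoClusterExchange w ({v} : Set (Fin n)) ({u, c} : Set (Fin n)) (s := v) (t := c)
    (by simp) (by simp)
    (A₁ := (openConn c u)ᶜ) (A₂ := univ) (B₁ := openConn c o) (B₂ := univ)
    (typePlus_not_openConn v c u) (fun _ _ _ _ _ => mem_univ _)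
    (typeMinus_openConn v c o) (fun _ _ _ _ _ => mem_univ _)
  simp only [sep_eq, inter_univ, openConn_symm c o] at key
  exact key

/-- **(b2) Exchange for `U` vs `{c↔o}` under `{v ↮ {u,c}}`**:
`μ(D'∩U∩{o↔c}) · μ(D') ≤ μ(D'∩U) · μ(D'∩{o↔c})`. [cite: VandenbergHaggstromKahn2005, Thm. 2.1 (p. 9) at q = 1] -/
theorem exch_event (w : Sym2 (Fin n) → unitInterval) (o u v c : Fin n) {U : Set (BondConfig (Fin n))}
    (hU : ∀ ⦃ω ω' : BondConfig (Fin n)⦄, openEdgeCluster ω v ⊆ openEdgeCluster ω' v → ω ∈ U → ω' ∈ U) :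
    (prodBernoulli w).real ((openConn u v)ᶜ ∩ (openConn v c)ᶜ ∩ (U ∩ openConn o c)) *
        (prodBernoulli w).real ((openConn u v)ᶜ ∩ (openConn v c)ᶜ : Set (BondConfig (Fin n))) ≤
      (prodBernoulli w).real ((openConn u v)ᶜ ∩ (openConn v c)ᶜ ∩ U) *
        (prodBernoulli w).real ((openConn u v)ᶜ ∩ (openConn v c)ᶜ ∩ openConn o c) := by
  have key := guardedTwoClusterExchange w ({v} : Set (Fin n)) ({u, c} : Set (Fin n)) (s := v) (t := c)
    (by simp) (by simp)
    (A₁ := U) (A₂ := univ) (B₁ := openConn c o) (B₂ := univ)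
    (fun _ _ h1 _ hω => hU h1 hω) (fun _ _ _ _ _ => mem_univ _)
    (typeMinus_openConn v c o) (fun _ _ _ _ _ => mem_univ _)
  simp only [sep_eq, inter_univ, openConn_symm c o] at key
  exact key

/-- The real bookkeeping: from `d·zU ≤ dU·z`, `e·z ≤ t·zJ`, `zUJ·z ≤ zU·zJ` (all quantities `≥ 0`,
`e ≤ t ≤ z`): `e·(dU·z − zU·d) ≤ t·(dU·zJ − zUJ·d)`. [folklore] -/
theorem alg {d dU z zU zJ zUJ t e : ℝ} (hd : 0 ≤ d) (hz : 0 ≤ z) (ht : 0 ≤ t) (he : 0 ≤ e)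
    (htz : t ≤ z) (het : e ≤ t)
    (ha : d * zU ≤ dU * z) (h1 : e * z ≤ t * zJ) (h2 : zUJ * z ≤ zU * zJ) :
    e * (dU * z - zU * d) ≤ t * (dU * zJ - zUJ * d) := by
  rcases hz.eq_or_lt with hz0 | hzpos
  · -- `z = 0` forces `t = e = 0`
    have ht0 : t = 0 := le_antisymm (hz0 ▸ htz) ht
    have he0 : e = 0 := le_antisymm (ht0 ▸ het) he
    simp [ht0, he0]
  · have hX : 0 ≤ dU * z - zU * d := by linarith
    have k1 : t * d * (zUJ * z) ≤ t * d * (zU * zJ) := mul_le_mul_of_nonneg_left h2 (mul_nonneg ht hd)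
    have k2 : e * z * (dU * z - zU * d) ≤ t * zJ * (dU * z - zU * d) :=
      mul_le_mul_of_nonneg_right h1 hX
    have key : 0 ≤ z * (t * (dU * zJ - zUJ * d) - e * (dU * z - zU * d)) := by nlinarith
    have := (mul_nonneg_iff_of_pos_left hzpos).1 key
    linarith

end KilledExchange

open KilledExchange in
/-- **Killed exchange inequality (EXK).**  For `μ = prodBernoulli w` on a weighted graph on `Fin n`,
relays `u ≠ v`, observer `o`, spectator `c`, and an event `U` increasing in the open cluster of `v`:
with `D = {u↮v}`, `D' = D ∩ {v↮c}`, `T3 = D ∩ {c↮u} ∩ {c↮v}`,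
`μ(T3 ∩ {o↔c}) · [μ(D∩U) μ(D') − μ(D'∩U) μ(D)] ≤ μ(T3) · [μ(D∩U) μ(D'∩{o↔c}) − μ(D'∩U∩{o↔c}) μ(D)]`.
Equivalently, for the law `ν = μ(·|D)` of `L = C_v` killed by the ghost `u`:
`μ(T3) · |Cov_ν(1_U, 1{c∉L, o∈C_c})| ≥ μ(T3∩{o↔c}) · |Cov_ν(1_U, 1{c∉L})|` — the exchange half of the
kernel's L-face inequality (SD); the other half is `μ(T3)·Cov_ν(1_U, 1{v↮o}1{o↮c}) ≤` this slack.
Proof: `mono_avoid` (BHK 1.3), `exch_guard`, `exch_event` (BHK 2.1 at `q=1` with the sets `{v}`,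
`{u,c}`), and `alg`.
[cite: VandenbergHaggstromKahn2005, Thm. 1.3 (p. 6), Thm. 2.1 (p. 9)] -/
theorem killedExchange {n : ℕ} (w : Sym2 (Fin n) → unitInterval) (o u v c : Fin n) (huv : u ≠ v)
    {U : Set (BondConfig (Fin n))}
    (hU : ∀ ⦃ω ω' : BondConfig (Fin n)⦄, openEdgeCluster ω v ⊆ openEdgeCluster ω' v → ω ∈ U → ω' ∈ U) :
    (prodBernoulli w).real ((openConn u v)ᶜ ∩ ((openConn c u)ᶜ ∩ (openConn c v)ᶜ) ∩ openConn o c) *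
        ((prodBernoulli w).real ((openConn u v)ᶜ ∩ U) *
            (prodBernoulli w).real ((openConn u v)ᶜ ∩ (openConn v c)ᶜ : Set (BondConfig (Fin n))) -
          (prodBernoulli w).real ((openConn u v)ᶜ ∩ (openConn v c)ᶜ ∩ U) *
            (prodBernoulli w).real ((openConn u v)ᶜ : Set (BondConfig (Fin n)))) ≤
      (prodBernoulli w).real ((openConn u v)ᶜ ∩ ((openConn c u)ᶜ ∩ (openConn c v)ᶜ) : Set (BondConfig (Fin n))) *
        ((prodBernoulli w).real ((openConn u v)ᶜ ∩ U) *
            (prodBernoulli w).real ((openConn u v)ᶜ ∩ (openConn v c)ᶜ ∩ openConn o c) -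
          (prodBernoulli w).real ((openConn u v)ᶜ ∩ (openConn v c)ᶜ ∩ U ∩ openConn o c) *
            (prodBernoulli w).real ((openConn u v)ᶜ : Set (BondConfig (Fin n)))) := by
  classical
  -- normal forms of the sets
  have eT : ((openConn u v)ᶜ ∩ ((openConn c u)ᶜ ∩ (openConn c v)ᶜ) : Set (BondConfig (Fin n))) =
      (openConn u v)ᶜ ∩ (openConn v c)ᶜ ∩ (openConn c u)ᶜ := by
    rw [openConn_symm c v]; ext ω; simp only [mem_inter_iff]; tauto
  have eE : ((openConn u v)ᶜ ∩ (openConn v c)ᶜ ∩ (openConn c u)ᶜ ∩ openConn o c : Set (BondConfig (Fin n))) =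
      (openConn u v)ᶜ ∩ (openConn v c)ᶜ ∩ ((openConn c u)ᶜ ∩ openConn o c) := by
    ext ω; simp only [mem_inter_iff]; tauto
  have eUJ : ((openConn u v)ᶜ ∩ (openConn v c)ᶜ ∩ U ∩ openConn o c : Set (BondConfig (Fin n))) =
      (openConn u v)ᶜ ∩ (openConn v c)ᶜ ∩ (U ∩ openConn o c) := by
    ext ω; simp only [mem_inter_iff]; tauto
  rw [eT, eE, eUJ]
  have ha := mono_avoid w u v c huv hU
  have h1 := exch_guard w o u v c
  have h2 := exch_event w o u v c hU
  -- sizes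
  have htz : (prodBernoulli w).real ((openConn u v)ᶜ ∩ (openConn v c)ᶜ ∩ (openConn c u)ᶜ) ≤
      (prodBernoulli w).real ((openConn u v)ᶜ ∩ (openConn v c)ᶜ : Set (BondConfig (Fin n))) :=
    measureReal_mono inter_subset_left
  have het : (prodBernoulli w).real ((openConn u v)ᶜ ∩ (openConn v c)ᶜ ∩ ((openConn c u)ᶜ ∩ openConn o c)) ≤
      (prodBernoulli w).real ((openConn u v)ᶜ ∩ (openConn v c)ᶜ ∩ (openConn c u)ᶜ) :=
    measureReal_mono (inter_subset_inter_right _ inter_subset_left)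
  exact alg measureReal_nonneg measureReal_nonneg measureReal_nonneg measureReal_nonneg htz het
    (by simpa only [mul_comm] using ha) (by simpa only [mul_comm] using h1)
    (by simpa only [mul_comm] using h2)

end Summit.CriticalPhenomena.PercolationContinuityZ3.Theorems
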